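import Literature.AlgebraicGeometry.HodgeTheory.WeilClassesFieldExceptionalOfCentralTrace
import Literature.AlgebraicGeometry.Deligne1982.WeilTypeCMQuadratic
import Literature.AlgebraicGeometry.HodgeTheory.WeilClassesRationalPlane
import Literature.AlgebraicGeometry.HodgeTheory.HodgeGroupProductCMFactorClasses
import Literature.AlgebraicGeometry.Milne1999.SpecialLefschetzGroupInvariantsImaginaryQuadratic
import HarnessLib

/-!
# Weil type with a CENTRAL generator: all non-zero Weil classes are exceptional, `Bⁿ ≠ Dⁿ`
# (Moonen–Zarhin 1998 Criterion (2), type 4 with `d = m = 1`, `F = K ⊄ E₀`; van Geemen 1994 Thm. 6.12; Weil 1977)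

Layer `Literature/AlgebraicGeometry/HodgeTheory`; THEOREMS ONLY — no definition, no named fact, no `sorry`, no instance.
Research context: cell `pub-hodgeav-hg6` (LADDER-HodgeAV PERC-SHAPE row 2, req-37 (A) Q2b, TABLE X rows 9 ∕ 11 ∕ 13 —
the simple Weil-type sixfolds with commutative `End⁰`; lead g4 T2, 2026-08-29). HONEST FRAMING: nothing here proves HC,
`HC_AV` or `HC_CM`; this file certifies that at these members the Hodge conjecture is NOT a statement about divisor
classes — the Weil plane carries rational Hodge classes outside the divisor ring.

## The print

B. J. J. Moonen, Yu. G. Zarhin, *Weil classes on abelian varieties*, J. reine angew. Math. **496** (1998) 83–92 =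
arXiv:alg-geom/9612017 [MoonenZarhin1998WeilClasses], §1 Criterion (2) (held chunk p0003 L59–L80), VERBATIM: «Suppose
`F ↪ End⁰(X)` is a subfield such that `W_F = ⋀^r_F V_X` consists of Hodge classes […]. Then either all classes in `W_F` are
decomposable, or all non-zero classes in `W_F` are exceptional; this last possibility occurs precisely in the following
cases: […] `Y` is of Type 4, `d = 1`, `m = 1` and `F ⊄ E₀`, `Y` is of Type 4 with `d ≥ 2` or `m ≥ 2` and the map
`θ : E₋ ↪ End_F(V_X) —Tr_F→ F` is non-zero.» and its proof (chunk p0003 L92–p0004): the centre `U_E` of `G_div` acts on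
`W_F` through `det_F`, with differential `θ`. B. van Geemen, *An introduction to the Hodge conjecture for abelian
varieties*, LNM 1594 (1994), Thm. 6.12 (after A. Weil, *Abelian varieties and the Hodge ring*, Œuvres III (1977)
421–429): for the general member `Bⁿ(X) = Dⁿ ⊕ ⋀^{2n}_K H¹(X, ℚ)`, `dim Bⁿ = 3`.

## What is proved — for EVERY Weil-type pair with CENTRAL `φ` (no Hodge-group hypothesis)

Carriers as in the tree: `(A, φ)` of Weil type `(n, d)` (`IsWeilType`: `dim A = 2n ≥ 2`, `φ ≫ φ = -(d • 𝟙 A)`, `d ≥ 1`,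
multiplicity `n` of `i√d` on `H^{1,0}`), Weil plane `W_K ⊗ ℂ = weilClassesOf A φ n d ⊆ H^{2n}(A(ℂ); ℂ)`, divisor ring
`Dⁿ ⊗ ℂ = divisorClassesSpan A.X A.dim n`, a polarization class `h` (rational, type `(1,1)`, hard Lefschetz) which is
`φ`-COMPATIBLE, `Q_h(φ^*x, φ^*y) = d · Q_h(x, y)` (van Geemen 4.9's «`E(φx, φy) = d E(x, y)`»; the binder `hφQ` of the TABLE X
rows), and **`φ` central in `End(A)`** (`φ ≫ ψ = ψ ≫ φ` for all `ψ`; e.g. `End⁰(A)` commutative — `End⁰ = K` exactly, or a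
CM field `E ∋ φ`: TABLE X rows 9, 11, 13). Then Moonen–Zarhin's map `θ` is non-zero at `u = φ`: the `Q_h`-adjoint of the
central pull-back `φ^*` is `−φ^*` (§1), `w = φ^* − (φ^*)† = 2φ^*` acts on `V_ρ = ker(φ^* − i√d)` by `2i√d`, and
`Tr(w | V_ρ) = 2i√d · dim V_ρ ≠ 0` (`dim V_ρ ≥ n ≥ 1`), so the tree's
`weilClassesField_inf_divisorClassesSpan_eq_bot_of_trace_ne_zero` (lit-hodgefound, MZ98 Criterion (2) on the carrier, for
every `A`) applies at `P = T² + d`: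
* §2 **`IsWeilType.weilClassesOf_inf_divisorClassesSpan_eq_bot_of_central`** — `W_K ⊗ ℂ ∩ Dⁿ ⊗ ℂ = 0`: ALL NON-ZERO WEIL
  CLASSES ARE EXCEPTIONAL;
* §3 **`IsWeilType.exists_isRationalClass_weilClass_not_mem_divisorClassesSpan_of_central`** — a RATIONAL Hodge class of
  type `(n, n)` in the Weil plane outside `Dⁿ ⊗ ℂ` (the plane is spanned by its rational classes,
  `exists_isRationalClass_ne_zero_mem_weilClassesOf`, all of type `(n, n)` under Weil type);
  **`IsWeilType.not_isDivisorGenerated_of_central`** — `B(A) ≠ D(A)` (`¬ IsDivisorGenerated A`).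

* §4 (v2) the same with CARRIER-LEVEL centrality `φ^* ∈ C(A) ⊗ ℂ` (`…_of_mem_centralizerAlgebra`), supplied from Milne's
  single-generator datum `hgen` (`pullbackOne_mem_centralizerAlgebra_of_forall_mem_adjoin`,
  `IsWeilType.not_isDivisorGenerated_of_forall_mem_adjoin`) — the binder shape of the TABLE X Weil rows.

For TABLE X this says: at every member of rows 9 ∕ 11 ∕ 13 the displayed residue binder (algebraicity of Weil classes on
sixfolds) is LOAD-BEARING — HC there is not a consequence of Lefschetz `(1,1)`. Not here: the decomposable direction
(`θ = 0`), non-central `φ` (products, `m ≥ 2`), and any statement about `Hg(A)`.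

## References

* [MoonenZarhin1998WeilClasses] B. J. J. Moonen, Yu. G. Zarhin, Weil classes on abelian varieties, J. reine angew. Math.
  496 (1998) 83–92; arXiv:alg-geom/9612017, §1 Criterion (2) and its proof (chunks p0003–p0004).
* [vanGeemen1994HodgeAV] B. van Geemen, An introduction to the Hodge conjecture for abelian varieties, in: Algebraic
  Cycles and Hodge Theory (Torino 1993), LNM 1594 (1994) 233–252, 4.9, Lemma 5.2, Thm. 6.12.
* [Weil1977HodgeRing] A. Weil, Abelian varieties and the Hodge ring, Œuvres Scientifiques III (1977) 421–429.
* [Milne1999LefschetzClasses] J. S. Milne, Lefschetz classes on abelian varieties, Duke Math. J. 96 (1999), Thm. 3.2,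
  Cor. 4.5, §4 p. 660.
-/

noncomputable section

namespace Literature.AlgebraicGeometry.HodgeTheory

open CategoryTheory Polynomial
open Literature.AlgebraicTopology.SingularHomology
open Literature.AlgebraicGeometry.Motives
open Literature.AlgebraicGeometry.VanGeemen1994 (pullbackOne)
open Literature.AlgebraicGeometry.Milne1999 (centralizerAlgebra mem_centralizerAlgebra_iff'
  pullbackOne_pullbackOne_of_comp_eq_neg)
open Literature.AlgebraicGeometry.Deligne1982 (eval₂_X_sq_add_C_eq_zero_iff eval₂_X_sq_add_C_End_eq_zero_iff
  irreducible_X_sq_add_C_rat weilClassesField_X_sq_add_C_eq_weilClassesOf)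
open Literature.Barriers.HodgeConjecture (divisorClassesSpan)
open Literature.Geometry.Kaehler (HasHardLefschetzProperty)

variable {A : AbelianVariety ℂ} {φ : A ⟶ A} {n d : ℕ} {h : complexBetti A.X 2}

/-! ### §1 A central `φ`: `φ^* ∈ C(A) ⊗ ℂ`, the adjoint of `φ^*` is `−φ^*`, and `Tr(2φ^* | V_{i√d}) ≠ 0` -/

/-- `(φ ≫ ψ)^* = φ^* ∘ ψ^*` on `H¹` (contravariance). [folklore] -/
private theorem pullbackOne_comp' (φ ψ : A ⟶ A) : pullbackOne A (φ ≫ ψ) = pullbackOne A φ * pullbackOne A ψ := by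
  change (complexBetti.map (φ.hom.hom.hom ≫ ψ.hom.hom.hom) 1).hom = _
  rw [complexBetti.map_comp, ModuleCat.hom_comp]
  rfl

/-- **A central endomorphism gives a central pull-back**: `φ ≫ ψ = ψ ≫ φ` for all `ψ` puts `φ^*` in Milne's
`C(A) ⊗ ℂ` (it commutes with every `ψ^*`). [cite: Milne1999LefschetzClasses, §1 p. 642 (definition of C(A))] -/
theorem pullbackOne_mem_centralizerAlgebra_of_central (hcen : ∀ ψ : A ⟶ A, φ ≫ ψ = ψ ≫ φ) :
    pullbackOne A φ ∈ centralizerAlgebra A := by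
  refine mem_centralizerAlgebra_iff'.2 fun ψ x => ?_
  rw [← Module.End.mul_apply, ← Module.End.mul_apply, ← pullbackOne_comp', ← pullbackOne_comp', hcen ψ]

/-- **The `Q_h`-adjoint of `φ^*` is `−φ^*`** for a `φ`-compatible class `h` (`Q_h(φ^*x, φ^*y) = d·Q_h(x, y)`) and
`φ ≫ φ = −d`: `Q_h(φ^*x, y) = −d⁻¹ Q_h(φ^*x, φ^*φ^*y) = −Q_h(x, φ^*y)` (van Geemen 4.9: «`E(x, φy) = −E(φx, y)` … the
Rosati involution induces complex conjugation on `K`»). [cite: vanGeemen1994HodgeAV, 4.9 and Lemma 5.2 (1)–(2)] -/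
theorem polarizationPairingOne_pullbackOne_eq_neg (hd : 0 < d) (hsq : φ ≫ φ = -(d • 𝟙 A))
    (hφQ : ∀ x y, polarizationPairingOne A.X h (A.dim - 1) (pullbackOne A φ x) (pullbackOne A φ y) =
      (d : ℂ) • polarizationPairingOne A.X h (A.dim - 1) x y) (x y : complexBetti A.X 1) :
    polarizationPairingOne A.X h (A.dim - 1) (pullbackOne A φ x) y =
      polarizationPairingOne A.X h (A.dim - 1) x ((-pullbackOne A φ) y) := by
  have hd0 : (d : ℂ) ≠ 0 := by exact_mod_cast hd.ne'
  have hy : y = -((d : ℂ)⁻¹ • pullbackOne A φ (pullbackOne A φ y)) := by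
    rw [pullbackOne_pullbackOne_of_comp_eq_neg φ hsq y, smul_neg, neg_neg, smul_smul, inv_mul_cancel₀ hd0, one_smul]
  conv_lhs => rw [hy]
  rw [map_neg, map_smul, hφQ, smul_smul, inv_mul_cancel₀ hd0, one_smul, LinearMap.neg_apply, map_neg]

/-- For a Weil-type pair the eigenspace `V_{i√d} = ker(φ^* − i√d) ⊆ H¹(A(ℂ); ℂ)` is non-zero (it contains the
`n`-dimensional `V_{i√d} ∩ H^{1,0}`, `n ≥ 1`). [cite: vanGeemen1994HodgeAV, 4.9] -/
theorem IsWeilType.finrank_eigenspace_pullbackOne_ne_zero (hW : IsWeilType A φ n d) :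
    Module.finrank ℂ (Module.End.eigenspace (pullbackOne A φ) (Complex.I * (Real.sqrt d : ℂ))) ≠ 0 := by
  haveI : FiniteDimensional ℂ (complexBetti A.X 1) := finite_complexBetti_abelianVariety A 1
  have hle := Submodule.finrank_mono (inf_le_left :
    Module.End.eigenspace (complexBetti.map φ.hom.hom.hom 1).hom (Complex.I * (Real.sqrt d : ℂ)) ⊓
      hodgeOneZero (Motives.isSmoothProjective_of_dim_eq' hW.dim_eq) ≤ _)
  rw [hW.multiplicity_eq] at hle
  have hn := hW.pos
  change Module.finrank ℂ (Module.End.eigenspace (complexBetti.map φ.hom.hom.hom 1).hom _) ≠ 0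
  omega

/-- **`θ ≠ 0` at `u = φ`**: on `V_ρ`, `ρ = i√d`, the operator `w = φ^* − (−φ^*)` is `2ρ · id`, so its trace is
`2ρ · dim V_ρ ≠ 0`. [cite: MoonenZarhin1998WeilClasses, §1 proof of Criterion (2) («the induced map on Lie algebras θ … is non-zero»)] -/
theorem IsWeilType.trace_restrict_sub_neg_pullbackOne_ne_zero (hW : IsWeilType A φ n d)
    (hw : ∀ x ∈ Module.End.eigenspace (pullbackOne A φ) (Complex.I * (Real.sqrt d : ℂ)),
      (pullbackOne A φ - -pullbackOne A φ) x ∈ Module.End.eigenspace (pullbackOne A φ) (Complex.I * (Real.sqrt d : ℂ))) :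
    LinearMap.trace ℂ _ ((pullbackOne A φ - -pullbackOne A φ).restrict hw) ≠ 0 := by
  haveI : FiniteDimensional ℂ (complexBetti A.X 1) := finite_complexBetti_abelianVariety A 1
  set ρ : ℂ := Complex.I * (Real.sqrt d : ℂ) with hρ
  have hρ0 : ρ ≠ 0 := by
    refine mul_ne_zero Complex.I_ne_zero ?_
    rw [Ne, Complex.ofReal_eq_zero, Real.sqrt_eq_zero (Nat.cast_nonneg d), Nat.cast_eq_zero]
    exact hW.d_pos.ne'
  have hrestr : (pullbackOne A φ - -pullbackOne A φ).restrict hw = (2 * ρ) • LinearMap.id := by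
    ext ⟨x, hx⟩
    have hx' : pullbackOne A φ x = ρ • x := Module.End.mem_eigenspace_iff.1 hx
    simp only [LinearMap.restrict_apply, sub_neg_eq_add, LinearMap.smul_apply, LinearMap.id_apply, SetLike.mk_smul_mk]
    rw [LinearMap.add_apply, hx', ← add_smul, two_mul]
  rw [hrestr, map_smul, LinearMap.trace_id, smul_eq_mul]
  refine mul_ne_zero (mul_ne_zero two_ne_zero hρ0) ?_
  exact_mod_cast hW.finrank_eigenspace_pullbackOne_ne_zero

/-! ### §2 All non-zero Weil classes are exceptional -/

/-- `T² + d` is monic of degree `2` and irreducible over `ℚ` for `d ≥ 1` (tree lemmas, packaged). [folklore] -/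
private theorem X_sq_add_C_facts' (hd : 0 < d) :
    (X ^ 2 + C (d : ℤ) : ℤ[X]).Monic ∧ (X ^ 2 + C (d : ℤ) : ℤ[X]).natDegree = 2 ∧
      Irreducible ((X ^ 2 + C (d : ℤ) : ℤ[X]).map (Int.castRingHom ℚ)) := by
  refine ⟨monic_X_pow_add_C _ (by norm_num), natDegree_X_pow_add_C, ?_⟩
  rw [Polynomial.map_add, Polynomial.map_pow, map_X, map_C, eq_intCast, Int.cast_natCast]
  exact irreducible_X_sq_add_C_rat hd

/-- **MOONEN–ZARHIN CRITERION (2) FOR A CENTRAL WEIL STRUCTURE — all non-zero classes of the Weil plane are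
EXCEPTIONAL: `W_K ⊗ ℂ ∩ Dⁿ ⊗ ℂ = 0`.** For `(A, φ)` of Weil type `(n, d)` with `φ` central in `End(A)` and a
`φ`-compatible polarization class `h` (rational, type `(1,1)`, hard Lefschetz, `Q_h(φ^*x, φ^*y) = d·Q_h(x, y)`):
Criterion (2), case «Type 4, `d = 1`, `m = 1`, `F = K ⊄ E₀`», through the tree's carrier theorem
`weilClassesField_inf_divisorClassesSpan_eq_bot_of_trace_ne_zero` at `P = T² + d`, `u = φ`, `(φ^*)† = −φ^*`,
`θ_ρ(2φ^*) = 2i√d · dim V_ρ ≠ 0` (§1), and the bridge `weilClassesField_X_sq_add_C_eq_weilClassesOf`. In particular at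
every member of TABLE X rows 9 ∕ 11 ∕ 13. [cite: MoonenZarhin1998WeilClasses, §1 Criterion (2) and its proof (chunks p0003–p0004)]
[cite: vanGeemen1994HodgeAV, Thm. 6.12] -/
theorem IsWeilType.weilClassesOf_inf_divisorClassesSpan_eq_bot_of_central (hW : IsWeilType A φ n d)
    (hcen : ∀ ψ : A ⟶ A, φ ≫ ψ = ψ ≫ φ) (hQ : IsRationalClass h) (h11 : IsOfHodgeType A.dim A.X 2 1 1 h)
    (hHL : HasHardLefschetzProperty h A.dim)
    (hφQ : ∀ x y, polarizationPairingOne A.X h (A.dim - 1) (pullbackOne A φ x) (pullbackOne A φ y) =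
      (d : ℂ) • polarizationPairingOne A.X h (A.dim - 1) x y) :
    weilClassesOf A φ n d ⊓ divisorClassesSpan A.X A.dim n = ⊥ := by
  have h1 : 1 ≤ A.dim := by rw [hW.dim_eq]; have := hW.pos; omega
  obtain ⟨hPm, hPe, hPirr⟩ := X_sq_add_C_facts' (d := d) hW.d_pos
  have hφP := (eval₂_X_sq_add_C_End_eq_zero_iff (φ := φ) (d := d)).2 hW.sq_eq
  have her : 2 * (2 * n) = 2 * A.dim := by rw [hW.dim_eq]
  have huC := pullbackOne_mem_centralizerAlgebra_of_central hcen
  have hY' := polarizationPairingOne_pullbackOne_eq_neg (h := h) hW.d_pos hW.sq_eq hφQ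
  have hρ : Polynomial.eval₂ (Int.castRingHom ℂ) (Complex.I * (Real.sqrt d : ℂ)) (X ^ 2 + C (d : ℤ)) = 0 :=
    eval₂_X_sq_add_C_eq_zero_iff.2 (Or.inl rfl)
  have hw := sub_adjoint_mapsTo_eigenspace h1 hQ h11 hHL huC hY' φ (Complex.I * (Real.sqrt d : ℂ))
  have htr := hW.trace_restrict_sub_neg_pullbackOne_ne_zero hw
  have key := weilClassesField_inf_divisorClassesSpan_eq_bot_of_trace_ne_zero h1 hQ h11 hHL hPm hPe hPirr hφP her
    hW.pos.ne' huC hY' hρ hw htr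
  rwa [weilClassesField_X_sq_add_C_eq_weilClassesOf] at key

/-! ### §3 A rational Hodge class outside the divisor ring; `B ≠ D` -/

/-- **A RATIONAL WEIL–HODGE CLASS OUTSIDE THE DIVISOR RING**: for `(A, φ)` of Weil type `(n, d)` with central `φ` and a
`φ`-compatible polarization class there is a rational class of Hodge type `(n, n)` in the Weil plane which does not lie
in `Dⁿ ⊗ ℂ` (the plane is spanned by its rational classes and meets `Dⁿ ⊗ ℂ` trivially, §2). Van Geemen: the Weil
classes of the general member are «examples due to A. Weil of abelian varieties for which the Hodge conjecture is still
open». [cite: vanGeemen1994HodgeAV, 1.1, 4.10 and Thm. 6.12] [cite: MoonenZarhin1998WeilClasses, §1 Criterion (2)] -/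
theorem IsWeilType.exists_isRationalClass_weilClass_not_mem_divisorClassesSpan_of_central (hW : IsWeilType A φ n d)
    (hcen : ∀ ψ : A ⟶ A, φ ≫ ψ = ψ ≫ φ) (hQ : IsRationalClass h) (h11 : IsOfHodgeType A.dim A.X 2 1 1 h)
    (hHL : HasHardLefschetzProperty h A.dim)
    (hφQ : ∀ x y, polarizationPairingOne A.X h (A.dim - 1) (pullbackOne A φ x) (pullbackOne A φ y) =
      (d : ℂ) • polarizationPairingOne A.X h (A.dim - 1) x y) :
    ∃ c ∈ weilClassesOf A φ n d, IsRationalClass c ∧ IsOfHodgeType A.dim A.X (2 * n) n n c ∧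
      c ∉ divisorClassesSpan A.X A.dim n := by
  obtain ⟨c, hc, hc0, hcQ⟩ := exists_isRationalClass_ne_zero_mem_weilClassesOf hW.pos hW.dim_eq hW.d_pos hW.sq_eq
  refine ⟨c, hc, hcQ, ?_, fun hcD => hc0 ?_⟩
  · rw [hW.dim_eq]
    exact hW.isOfHodgeType_of_mem_weilClassesOf hc
  · have hbot := hW.weilClassesOf_inf_divisorClassesSpan_eq_bot_of_central hcen hQ h11 hHL hφQ
    have hmem : c ∈ weilClassesOf A φ n d ⊓ divisorClassesSpan A.X A.dim n := ⟨hc, hcD⟩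
    rw [hbot] at hmem
    exact (Submodule.mem_bot ℂ).1 hmem

/-- **`B(A) ≠ D(A)` FOR A CENTRAL WEIL STRUCTURE**: an abelian variety of Weil type `(n, d)` whose `φ` is central in
`End(A)`, with a `φ`-compatible polarization class, is NOT divisor-generated (`Bⁿ ⊗ ℂ ⊋ Dⁿ ⊗ ℂ`: §3's class). For TABLE X
rows 9 ∕ 11 ∕ 13 (simple Weil sixfolds with commutative `End⁰`): the displayed residue binder — algebraicity of the Weil
classes — is load-bearing; HC there is not a divisor statement. [cite: vanGeemen1994HodgeAV, Thm. 6.12 and 1.1]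
[cite: Weil1977HodgeRing] [cite: MoonenZarhin1998WeilClasses, §1 Criterion (2)] -/
theorem IsWeilType.not_isDivisorGenerated_of_central (hW : IsWeilType A φ n d)
    (hcen : ∀ ψ : A ⟶ A, φ ≫ ψ = ψ ≫ φ) (hQ : IsRationalClass h) (h11 : IsOfHodgeType A.dim A.X 2 1 1 h)
    (hHL : HasHardLefschetzProperty h A.dim)
    (hφQ : ∀ x y, polarizationPairingOne A.X h (A.dim - 1) (pullbackOne A φ x) (pullbackOne A φ y) =
      (d : ℂ) • polarizationPairingOne A.X h (A.dim - 1) x y) :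
    ¬ IsDivisorGenerated A := by
  intro hD
  obtain ⟨c, -, hcQ, hcH, hcD⟩ :=
    hW.exists_isRationalClass_weilClass_not_mem_divisorClassesSpan_of_central hcen hQ h11 hHL hφQ
  exact hcD (hD n c hcQ hcH)

/-! ### §4 (v2) Carrier-level centrality: `φ^* ∈ C(A) ⊗ ℂ` from single generation, and §2–§3 in that form
(TABLE X rows 9 ∕ 11 ∕ 13 ∕ 19: `End⁰(A) ⊗ ℂ = ℂ[φ_E^*]` on `H¹`) -/

section Carrier

open Literature.AlgebraicGeometry.Milne1999 (mem_centralizerAlgebra_iff)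

/-- **Single generation makes every pull-back central**: if every `ψ^*` lies in `ℂ[φ_E^*]` (Milne's single-generator datum
`hgen` of the TABLE X Weil rows — `End⁰(A) ⊗ ℂ` commutative on `H¹`), then `φ^* ∈ C(A) ⊗ ℂ` for every `φ ∈ End(A)`
(two polynomials in `φ_E^*` commute). [cite: Milne1999LefschetzClasses, §1 p. 642 (definition of C(A))] -/
theorem pullbackOne_mem_centralizerAlgebra_of_forall_mem_adjoin {φE : A ⟶ A}
    (hgen : ∀ ψ : A ⟶ A, pullbackOne A ψ ∈ Algebra.adjoin ℂ {pullbackOne A φE}) :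
    pullbackOne A φ ∈ centralizerAlgebra A := by
  refine mem_centralizerAlgebra_iff.2 fun ψ => ?_
  have hψ := hgen ψ
  have hφ := hgen φ
  rw [Algebra.adjoin_singleton_eq_range_aeval] at hψ hφ
  obtain ⟨p, hp⟩ := (AlgHom.mem_range _).1 hψ
  obtain ⟨q, hq⟩ := (AlgHom.mem_range _).1 hφ
  rw [← hp, ← hq, ← map_mul, ← map_mul, mul_comm]

/-- **§2 with carrier-level centrality**: `W_K ⊗ ℂ ∩ Dⁿ ⊗ ℂ = 0` for `(A, φ)` of Weil type `(n, d)` with `φ^* ∈ C(A) ⊗ ℂ`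
(e.g. from `hgen` above) and a `φ`-compatible polarization class — the proof of
`IsWeilType.weilClassesOf_inf_divisorClassesSpan_eq_bot_of_central` from the point where `φ^*` is central on the carrier.
[cite: MoonenZarhin1998WeilClasses, §1 Criterion (2) and its proof (chunks p0003–p0004)] [cite: vanGeemen1994HodgeAV, Thm. 6.12] -/
theorem IsWeilType.weilClassesOf_inf_divisorClassesSpan_eq_bot_of_mem_centralizerAlgebra (hW : IsWeilType A φ n d)
    (huC : pullbackOne A φ ∈ centralizerAlgebra A) (hQ : IsRationalClass h) (h11 : IsOfHodgeType A.dim A.X 2 1 1 h)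
    (hHL : HasHardLefschetzProperty h A.dim)
    (hφQ : ∀ x y, polarizationPairingOne A.X h (A.dim - 1) (pullbackOne A φ x) (pullbackOne A φ y) =
      (d : ℂ) • polarizationPairingOne A.X h (A.dim - 1) x y) :
    weilClassesOf A φ n d ⊓ divisorClassesSpan A.X A.dim n = ⊥ := by
  have h1 : 1 ≤ A.dim := by rw [hW.dim_eq]; have := hW.pos; omega
  obtain ⟨hPm, hPe, hPirr⟩ := X_sq_add_C_facts' (d := d) hW.d_pos
  have hφP := (eval₂_X_sq_add_C_End_eq_zero_iff (φ := φ) (d := d)).2 hW.sq_eq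
  have her : 2 * (2 * n) = 2 * A.dim := by rw [hW.dim_eq]
  have hY' := polarizationPairingOne_pullbackOne_eq_neg (h := h) hW.d_pos hW.sq_eq hφQ
  have hρ : Polynomial.eval₂ (Int.castRingHom ℂ) (Complex.I * (Real.sqrt d : ℂ)) (X ^ 2 + C (d : ℤ)) = 0 :=
    eval₂_X_sq_add_C_eq_zero_iff.2 (Or.inl rfl)
  have hw := sub_adjoint_mapsTo_eigenspace h1 hQ h11 hHL huC hY' φ (Complex.I * (Real.sqrt d : ℂ))
  have htr := hW.trace_restrict_sub_neg_pullbackOne_ne_zero hw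
  have key := weilClassesField_inf_divisorClassesSpan_eq_bot_of_trace_ne_zero h1 hQ h11 hHL hPm hPe hPirr hφP her
    hW.pos.ne' huC hY' hρ hw htr
  rwa [weilClassesField_X_sq_add_C_eq_weilClassesOf] at key

/-- **§3 with carrier-level centrality**: a rational `(n, n)` Weil–Hodge class outside `Dⁿ ⊗ ℂ`.
[cite: vanGeemen1994HodgeAV, 1.1, 4.10 and Thm. 6.12] [cite: MoonenZarhin1998WeilClasses, §1 Criterion (2)] -/
theorem IsWeilType.exists_isRationalClass_weilClass_not_mem_divisorClassesSpan_of_mem_centralizerAlgebra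
    (hW : IsWeilType A φ n d) (huC : pullbackOne A φ ∈ centralizerAlgebra A) (hQ : IsRationalClass h)
    (h11 : IsOfHodgeType A.dim A.X 2 1 1 h) (hHL : HasHardLefschetzProperty h A.dim)
    (hφQ : ∀ x y, polarizationPairingOne A.X h (A.dim - 1) (pullbackOne A φ x) (pullbackOne A φ y) =
      (d : ℂ) • polarizationPairingOne A.X h (A.dim - 1) x y) :
    ∃ c ∈ weilClassesOf A φ n d, IsRationalClass c ∧ IsOfHodgeType A.dim A.X (2 * n) n n c ∧
      c ∉ divisorClassesSpan A.X A.dim n := by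
  obtain ⟨c, hc, hc0, hcQ⟩ := exists_isRationalClass_ne_zero_mem_weilClassesOf hW.pos hW.dim_eq hW.d_pos hW.sq_eq
  refine ⟨c, hc, hcQ, ?_, fun hcD => hc0 ?_⟩
  · rw [hW.dim_eq]
    exact hW.isOfHodgeType_of_mem_weilClassesOf hc
  · have hbot := hW.weilClassesOf_inf_divisorClassesSpan_eq_bot_of_mem_centralizerAlgebra huC hQ h11 hHL hφQ
    have hmem : c ∈ weilClassesOf A φ n d ⊓ divisorClassesSpan A.X A.dim n := ⟨hc, hcD⟩
    rw [hbot] at hmem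
    exact (Submodule.mem_bot ℂ).1 hmem

/-- **`B(A) ≠ D(A)` with carrier-level centrality** — for every Weil-type `(A, φ)` whose `φ^*` is central in
`End⁰(A) ⊗ ℂ` on `H¹` (TABLE X rows 9 ∕ 11 ∕ 13 ∕ 19 via `pullbackOne_mem_centralizerAlgebra_of_forall_mem_adjoin`) and
every `φ`-compatible polarization class: `A` is NOT divisor-generated. [cite: vanGeemen1994HodgeAV, Thm. 6.12 and 1.1]
[cite: Weil1977HodgeRing] [cite: MoonenZarhin1998WeilClasses, §1 Criterion (2)] -/
theorem IsWeilType.not_isDivisorGenerated_of_mem_centralizerAlgebra (hW : IsWeilType A φ n d)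
    (huC : pullbackOne A φ ∈ centralizerAlgebra A) (hQ : IsRationalClass h) (h11 : IsOfHodgeType A.dim A.X 2 1 1 h)
    (hHL : HasHardLefschetzProperty h A.dim)
    (hφQ : ∀ x y, polarizationPairingOne A.X h (A.dim - 1) (pullbackOne A φ x) (pullbackOne A φ y) =
      (d : ℂ) • polarizationPairingOne A.X h (A.dim - 1) x y) :
    ¬ IsDivisorGenerated A := by
  intro hD
  obtain ⟨c, -, hcQ, hcH, hcD⟩ :=
    hW.exists_isRationalClass_weilClass_not_mem_divisorClassesSpan_of_mem_centralizerAlgebra huC hQ h11 hHL hφQ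
  exact hcD (hD n c hcQ hcH)

/-- **`B(A) ≠ D(A)` from Milne's single-generator datum** (`hgen`: every pull-back is a polynomial in `φ_E^*`; TABLE X rows
11 ∕ 13 ∕ 19, and row 9 with `φ_E = φ`). [cite: vanGeemen1994HodgeAV, Thm. 6.12] [cite: MoonenZarhin1998WeilClasses, §1 Criterion (2)]
[cite: Milne1999LefschetzClasses, §1 p. 642] -/
theorem IsWeilType.not_isDivisorGenerated_of_forall_mem_adjoin (hW : IsWeilType A φ n d) {φE : A ⟶ A}
    (hgen : ∀ ψ : A ⟶ A, pullbackOne A ψ ∈ Algebra.adjoin ℂ {pullbackOne A φE}) (hQ : IsRationalClass h)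
    (h11 : IsOfHodgeType A.dim A.X 2 1 1 h) (hHL : HasHardLefschetzProperty h A.dim)
    (hφQ : ∀ x y, polarizationPairingOne A.X h (A.dim - 1) (pullbackOne A φ x) (pullbackOne A φ y) =
      (d : ℂ) • polarizationPairingOne A.X h (A.dim - 1) x y) :
    ¬ IsDivisorGenerated A :=
  hW.not_isDivisorGenerated_of_mem_centralizerAlgebra (pullbackOne_mem_centralizerAlgebra_of_forall_mem_adjoin hgen)
    hQ h11 hHL hφQ

end Carrier

end Literature.AlgebraicGeometry.HodgeTheory

end
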